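import Literature.Combinatorics.StablePolynomials.SymmetrizationClosedDomains
import HarnessLib

/-!
# A sufficient condition for preserving `𝔻̄`-stability (Borcea–Brändén I, Theorem 7.2 for `C̄ = 𝔻̄`)

J. Borcea, P. Brändén, *The Lee–Yang and Pólya–Schur programs. I. Linear operators preserving stability*,
Invent. Math. 177 (2009) 541–569 (arXiv:0809.0401), §7:

> **Theorem 7.2.** Let `κ ∈ ℕⁿ`, `T : ℂ_κ[z_1,…,z_n] → ℂ[z_1,…,z_n]` a linear operator and `C̄` a convex closed
> circular domain given by `C̄ = φ^{-1}(H̄)`, where `φ` is a Möbius transformation as in (6.1). If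
> `T[((az+b)(cw+d)+(aw+b)(cz+d))^κ]` is `C̄`-stable then `T` preserves `C̄`-stability.
>
> As noted in Remark 6.1, for the closed unit disk `C̄ = 𝔻̄` the symbol used in Theorem 7.2 is just a constant
> multiple of `T[(1+zw)^κ]` […].

This file proves the case `C̄ = 𝔻̄`: if the `𝔻`-symbol `T[(1+zw)^κ]` (the tree's `boundedDegreeSymbolD κ T`) has
no zeros with all `|z_i|, |w_i| ≤ 1`, then for every `f ∈ ℂ_κ[z]` without zeros in the closed unit polydisc,
`T(f)` has no zeros there or is identically zero. Proof (no proof is printed; "the arguments carry over"):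
by compactness the symbol has no zeros on a polydisc of radius `ρ > 1` (`exists_gt_radius_of_closedPolydisc`);
the conjugate `T' = S_ρ ∘ T ∘ S_ρ`, `S_ρ(f)(z) = f(ρz)`, then has a `𝔻`-stable `𝔻`-symbol
(`T'[(1+zw)^κ](z,w) = T[(1+zw)^κ](ρz,ρw)`), so it preserves `𝔻`-stability by Theorem 3.2 of part II
(`BorceaBranden_diskStabilityPreserver_iff`, the tree's `DiskStabilityPreservers.lean`); apply it to
`f(z/ρ)`, which is `𝔻`-stable, and read off `T(f)(ρz)`.

## Main results (namespace `Literature.Combinatorics.StablePolynomials`)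

* `affineSubst_prod_one_add_C_mul_X_pow`, `eval_boundedDegreeSymbolD_scaleConj` (the symbol of `S_ρ T S_ρ`).
* **`BorceaBranden_closedDiskStabilityPreserver`** — Theorem 7.2 for `C̄ = 𝔻̄`.

## References

* [BorceaBranden2009] J. Borcea, P. Brändén, Invent. Math. 177 (2009) 541–569, §7 Thm. 7.2, Remark 6.1.
* [BorceaBranden2009II] J. Borcea, P. Brändén, Comm. Pure Appl. Math. 62 (2009) 1595–1631, §3 Thm. 3.2 (`C = 𝔻`).
-/

noncomputable section

open MvPolynomial Finset

namespace Literature.Combinatorics.StablePolynomials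

variable {τ : Type*} [Fintype τ] [DecidableEq τ]

omit [DecidableEq τ] in
/-- `S_a(Π_i (1 + w_i z_i)^{κ_i}) = Π_i (1 + (a w_i) z_i)^{κ_i}` for the scaling `S_a(f)(z) = f(az)`.
[cite: BorceaBranden2009, §7 Thm. 7.2 with Remark 6.1 (the symbol `T[(1+zw)^κ]`)] -/
theorem affineSubst_prod_one_add_C_mul_X_pow (a : ℂ) (κ : τ → ℕ) (w : τ → ℂ) :
    affineSubst a 0 (∏ i, (1 + C (w i) * X i) ^ κ i : MvPolynomial τ ℂ) =
      ∏ i, (1 + C (a * w i) * X i) ^ κ i := by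
  rw [map_prod]
  refine Finset.prod_congr rfl fun i _ => ?_
  rw [map_pow, map_add, map_one, map_mul, affineSubst, bind₁_C_right, bind₁_X_right, map_zero, add_zero,
    map_mul, ← mul_assoc, mul_comm (C (w i)) (C a)]

/-- **The `𝔻`-symbol of the conjugate `S_a ∘ T ∘ S_a`** is the rescaled symbol:
`(S_a T S_a)[(1+zw)^κ](z,w) = T[(1+zw)^κ](az,aw)`. [cite: BorceaBranden2009, §7 Thm. 7.2 (`C̄ = 𝔻̄`);
BorceaBranden2009II, §3 Thm. 3.2 (the symbol `T[(1+zw)^κ]`)] -/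
theorem eval_boundedDegreeSymbolD_scaleConj (κ : τ → ℕ) (T : MvPolynomial τ ℂ →ₗ[ℂ] MvPolynomial τ ℂ)
    (a : ℂ) (z w : τ → ℂ) :
    eval (Sum.elim z w) (boundedDegreeSymbolD κ
      ((affineSubst a 0).toLinearMap ∘ₗ T ∘ₗ (affineSubst a 0).toLinearMap)) =
      eval (Sum.elim (fun i => a * z i) fun i => a * w i) (boundedDegreeSymbolD κ T) := by
  rw [eval_boundedDegreeSymbolD, eval_boundedDegreeSymbolD, LinearMap.comp_apply, LinearMap.comp_apply,
    AlgHom.toLinearMap_apply, AlgHom.toLinearMap_apply, affineSubst_prod_one_add_C_mul_X_pow,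
    eval_affineSubst]
  simp only [add_zero]

/-- **Borcea–Brändén I, Theorem 7.2 for the closed unit disc `C̄ = 𝔻̄`.** Let `T : ℂ_κ[z] → ℂ[z]` be linear and
suppose its `𝔻`-symbol `T[(1+zw)^κ]` has no zeros with all `|z_i| ≤ 1`, `|w_i| ≤ 1`. Then for every
`f ∈ ℂ_κ[z]` with no zeros in the closed unit polydisc `𝔻̄ⁿ`, `T(f)` has no zeros in `𝔻̄ⁿ` or is identically
zero. [cite: BorceaBranden2009, §7 Thm. 7.2 (`C̄ = 𝔻̄`, via Remark 6.1)] -/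
theorem BorceaBranden_closedDiskStabilityPreserver (κ : τ → ℕ) (T : MvPolynomial τ ℂ →ₗ[ℂ] MvPolynomial τ ℂ)
    (hT : ∀ u : τ ⊕ τ → ℂ, (∀ j, ‖u j‖ ≤ 1) → eval u (boundedDegreeSymbolD κ T) ≠ 0)
    {f : MvPolynomial τ ℂ} (hf : ∀ i, degreeOf i f ≤ κ i)
    (hfs : ∀ z : τ → ℂ, (∀ i, ‖z i‖ ≤ 1) → eval z f ≠ 0) :
    (∀ z : τ → ℂ, (∀ i, ‖z i‖ ≤ 1) → eval z (T f) ≠ 0) ∨ T f = 0 := by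
  -- the symbol is zero-free on a polydisc of radius `ρ > 1`
  obtain ⟨ρ, hρ1, hρ⟩ := exists_gt_radius_of_closedPolydisc (f := boundedDegreeSymbolD κ T) 0 zero_le_one
    (fun u hu => hT u fun j => by simpa using hu j)
  have hρ0 : 0 < ρ := zero_lt_one.trans hρ1
  have hρc : (ρ : ℂ) ≠ 0 := Complex.ofReal_ne_zero.2 hρ0.ne'
  -- the conjugate `T' = S_ρ T S_ρ` preserves `𝔻`-stability
  set S : MvPolynomial τ ℂ →ₗ[ℂ] MvPolynomial τ ℂ := (affineSubst (ρ : ℂ) 0).toLinearMap with hS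
  set T' : MvPolynomial τ ℂ →ₗ[ℂ] MvPolynomial τ ℂ := S ∘ₗ T ∘ₗ S with hT'
  have hsymb : IsDiskStable (boundedDegreeSymbolD κ T') := by
    intro u hu
    rw [← Sum.elim_comp_inl_inr u, hT', hS, eval_boundedDegreeSymbolD_scaleConj]
    refine hρ _ fun j => ?_
    rcases j with i | i
    · simp only [Sum.elim_inl, Function.comp_apply, sub_zero, norm_mul, Complex.norm_real,
        Real.norm_of_nonneg hρ0.le]
      calc ρ * ‖u (Sum.inl i)‖ < ρ * 1 := mul_lt_mul_of_pos_left (hu _) hρ0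
        _ = ρ := mul_one ρ
    · simp only [Sum.elim_inr, Function.comp_apply, sub_zero, norm_mul, Complex.norm_real,
        Real.norm_of_nonneg hρ0.le]
      calc ρ * ‖u (Sum.inr i)‖ < ρ * 1 := mul_lt_mul_of_pos_left (hu _) hρ0
        _ = ρ := mul_one ρ
  have hpres := (BorceaBranden_diskStabilityPreserver_iff κ T').2 (Or.inr hsymb)
  -- apply it to `p(z) = f(z/ρ)`
  set p := affineSubst (ρ : ℂ)⁻¹ 0 f with hp
  have hpdeg : ∀ i, degreeOf i p ≤ κ i := fun i => (degreeOf_affineSubst_le _ _ f i).trans (hf i)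
  have hpst : IsDiskStable p := by
    intro z hz
    rw [hp, eval_affineSubst]
    refine hfs _ fun i => ?_
    rw [add_zero, norm_mul, norm_inv, Complex.norm_real, Real.norm_of_nonneg hρ0.le]
    calc ρ⁻¹ * ‖z i‖ ≤ 1 * 1 :=
        mul_le_mul (inv_le_one_of_one_le₀ hρ1.le) (hz i).le (norm_nonneg _) zero_le_one
      _ = 1 := mul_one 1
  have hSp : S p = f := by
    rw [hS, AlgHom.toLinearMap_apply, hp, affineSubst_affineSubst, inv_mul_cancel₀ hρc, mul_zero, add_zero,
      affineSubst_one_zero]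
  have hT'p : T' p = affineSubst (ρ : ℂ) 0 (T f) := by
    rw [hT', LinearMap.comp_apply, LinearMap.comp_apply, hSp, hS, AlgHom.toLinearMap_apply]
  rcases hpres p hpdeg hpst with h | h
  · left
    intro z hz
    have hz' : ∀ i, ‖(ρ : ℂ)⁻¹ * z i‖ < 1 := fun i => by
      rw [norm_mul, norm_inv, Complex.norm_real, Real.norm_of_nonneg hρ0.le]
      calc ρ⁻¹ * ‖z i‖ ≤ ρ⁻¹ * 1 := mul_le_mul_of_nonneg_left (hz i) (inv_nonneg.2 hρ0.le)
        _ < 1 := by rw [mul_one]; exact inv_lt_one_of_one_lt₀ hρ1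
    have hval := h _ hz'
    rw [hT'p, eval_affineSubst] at hval
    have heq : (fun i => (ρ : ℂ) * ((ρ : ℂ)⁻¹ * z i) + 0) = z := funext fun i => by
      rw [add_zero, ← mul_assoc, mul_inv_cancel₀ hρc, one_mul]
    rwa [heq] at hval
  · right
    rw [hT'p] at h
    have h' := congr_arg (affineSubst (ρ : ℂ)⁻¹ 0) h
    rwa [affineSubst_affineSubst, mul_inv_cancel₀ hρc, mul_zero, add_zero, affineSubst_one_zero,
      map_zero] at h'

end Literature.Combinatorics.StablePolynomials

end
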